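import Summits.Ventures.HSemireg.WedgeHankelRecurrenceGaussChebyshevIntegerGcd

/-!
# Venture HSemireg — **HALF-ANGLE FACTORISATIONS (CHEBYSHEV POLYNOMIALS OF THE THIRD AND FOURTH KIND): `T_{2k+1} − 1 = (X − 1)(U_k + U_{k−1})²`, `T_{2k+1} + 1 = (X + 1)(U_k − U_{k−1})²`,
# `T_{2k} − 1 = 2 (X² − 1) U_{k−1}²`, `T_{2k} + 1 = 2 T_k²`** for all `k ∈ ℤ` in every commutative ring (`W_k = U_k + U_{k−1}` and `V_k = U_k − U_{k−1}` are the fourth- and third-kind polynomials,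
# `W_k(cos θ) = sin((k+½)θ) ∕ sin(θ∕2)`): so the points where `T_{2k+1} = 1` are `x = 1` and the (double) GAUSS–RADAU–CHEBYSHEV nodes `cos(2jπ∕(2k+1))`, the zeros of `W_k` — from the
# product-to-sum identity N462 `T_{k+j} − T_{k−j} = 2(X²−1) U_{j−1} U_{k−1}`, cancelling `2(X ± 1)` over `ℤ` and mapping to `R`

HONEST FRAMING. Part of the Lean index of the computation cell `pub-hsemireg` (seat p10 gen 48, Sunday typer «UNIFORM-IN-n»).  Polynomial algebra only; no variety, no cohomology theory, no sheaf,
no Ext group and no semiregularity map is constructed here; nothing here says that HC / HC_CM / HC_AV holds; no Literature fact (unproved `Prop`) is declared or used.  Custodian versions as in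
`WedgeHankelSiegelIdeal` (1/3).
SOURCES (cited).  J. C. Mason, D. C. Handscomb, *Chebyshev Polynomials* (2003), §1.2.3–1.2.4 (third and fourth kinds `V_n`, `W_n`, relations with `T`, `U`); W. Gautschi, *Orthogonal Polynomials:
Computation and Approximation* (2004), Ex. 1.x (Gauss–Radau–Chebyshev rules).
PROOF TYPED HERE.  N462 `chebyshevT_add_sub_T_sub`; Mathlib `T_mul_T`, `T_add_two`, `T_neg`, `T_zero ∕ T_one`, `map_T ∕ map_U`, `mul_left_cancel₀`, `X_add_C_ne_zero`.
DEDUP DISCLOSURE (`rg -n 'chebyshevT_two_mul_add_one_sub_one|chebyshevT_two_mul_add_one_add_one|chebyshevT_two_mul_sub_one_eq|chebyshevT_two_mul_add_one_eq_two_mul_sq|eval_eq_one_iff' Summits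
Literature HarnessLib`, 2026-09-04): N433 `chebyshevT_dvd_T_two_mul_add_one` (`T_n ∣ T_{2n} + 1`), N443 Pell, `Literature…ChebyshevExplicitForms` (explicit coefficient forms) — different statements; 0 hits
for the 6 names below.

WHAT IS IN THE TREE.  N433, N443, N462.
THIS FILE (namespace `Summit.Ventures.HSemireg.Wedge.HankelOuter` continued; CHAINED on N477; 0 definitions):
* §1243 `chebyshevT_two_mul_sub_one_eq` (`T_{2k} − 1 = 2(X²−1)U_{k−1}²`), `chebyshevT_two_mul_add_one_eq_two_mul_sq` (`T_{2k} + 1 = 2T_k²`), **`chebyshevT_two_mul_add_one_sub_one`**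
  (`T_{2k+1} − 1 = (X−1)(U_k+U_{k−1})²`), **`chebyshevT_two_mul_add_one_add_one`** (`T_{2k+1} + 1 = (X+1)(U_k−U_{k−1})²`), `chebyshevT_two_mul_add_one_eval_eq_one_iff`,
  `chebyshevT_two_mul_add_one_eval_eq_neg_one_iff`.
CAVEATS.  Nothing Ext-side.  New names only.
-/

open Module Polynomial
open scoped Matrix Polynomial

namespace Summit.Ventures.HSemireg.Wedge.HankelOuter

/-! ## §1243. Half-angle factorisations -/

/-- **`T_{2k} − 1 = 2 (X² − 1) U_{k−1}²`** (all `k ∈ ℤ`, any commutative ring). [Mason–Handscomb §1.2; this file, §1243] -/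
theorem chebyshevT_two_mul_sub_one_eq {R : Type*} [CommRing R] (k : ℤ) :
    Polynomial.Chebyshev.T R (2 * k) - 1 = 2 * (Polynomial.X ^ 2 - 1) * Polynomial.Chebyshev.U R (k - 1) ^ 2 := by
  have h := chebyshevT_add_sub_T_sub (R := R) k k
  rw [show k + k = 2 * k by ring, sub_self, Polynomial.Chebyshev.T_zero] at h
  rw [h]; ring

/-- **`T_{2k} + 1 = 2 T_k²`** (all `k ∈ ℤ`, any commutative ring). [Mathlib `T_mul_T`; this file, §1243] -/
theorem chebyshevT_two_mul_add_one_eq_two_mul_sq {R : Type*} [CommRing R] (k : ℤ) :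
    Polynomial.Chebyshev.T R (2 * k) + 1 = 2 * Polynomial.Chebyshev.T R k ^ 2 := by
  have h := Polynomial.Chebyshev.T_mul_T R k k
  rw [show k + k = 2 * k by ring, sub_self, Polynomial.Chebyshev.T_zero] at h
  linear_combination (-1 : R[X]) * h

/-- Over `ℤ`: `2 (X² − 1) (U_k ± U_{k−1})² = 2 (X ± 1) (T_{2k+1} ∓ 1)` (the product-to-sum identities summed). [this file, §1243] -/
theorem chebyshevT_two_mul_add_one_aux {R : Type*} [CommRing R] (k : ℤ) :
    2 * (Polynomial.X ^ 2 - 1) * (Polynomial.Chebyshev.U R k + Polynomial.Chebyshev.U R (k - 1)) ^ 2 =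
        2 * (Polynomial.X + 1) * (Polynomial.Chebyshev.T R (2 * k + 1) - 1) ∧
      2 * (Polynomial.X ^ 2 - 1) * (Polynomial.Chebyshev.U R k - Polynomial.Chebyshev.U R (k - 1)) ^ 2 =
        2 * (Polynomial.X - 1) * (Polynomial.Chebyshev.T R (2 * k + 1) + 1) := by
  have h1 := chebyshevT_add_sub_T_sub (R := R) (k + 1) (k + 1)
  have h2 := chebyshevT_add_sub_T_sub (R := R) (k + 1) k
  have h3 := chebyshevT_add_sub_T_sub (R := R) k k
  have h4 := Polynomial.Chebyshev.T_add_two R (2 * k)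
  rw [show k + 1 + (k + 1) = 2 * k + 2 by ring, sub_self, Polynomial.Chebyshev.T_zero, add_sub_cancel_right] at h1
  rw [show k + (k + 1) = 2 * k + 1 by ring, show k - (k + 1) = -1 by ring, Polynomial.Chebyshev.T_neg, Polynomial.Chebyshev.T_one, add_sub_cancel_right] at h2
  rw [show k + k = 2 * k by ring, sub_self, Polynomial.Chebyshev.T_zero] at h3
  constructor
  · linear_combination (-1 : R[X]) * h1 - 2 * h2 - h3 + h4
  · linear_combination (-1 : R[X]) * h1 + 2 * h2 - h3 + h4

/-- **`T_{2k+1} − 1 = (X − 1)(U_k + U_{k−1})²`** (all `k ∈ ℤ`, any commutative ring; `U_k + U_{k−1} = W_k`, the fourth-kind Chebyshev polynomial). [Mason–Handscomb (1.18)–(1.20); this file, §1243] -/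
theorem chebyshevT_two_mul_add_one_sub_one {R : Type*} [CommRing R] (k : ℤ) :
    Polynomial.Chebyshev.T R (2 * k + 1) - 1 = (Polynomial.X - 1) * (Polynomial.Chebyshev.U R k + Polynomial.Chebyshev.U R (k - 1)) ^ 2 := by
  -- over `ℤ` by cancelling `2 (X + 1)`, then map
  have hZ : Polynomial.Chebyshev.T ℤ (2 * k + 1) - 1 = (Polynomial.X - 1) * (Polynomial.Chebyshev.U ℤ k + Polynomial.Chebyshev.U ℤ (k - 1)) ^ 2 := by
    have h := (chebyshevT_two_mul_add_one_aux (R := ℤ) k).1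
    have hne : (2 * (Polynomial.X + 1) : ℤ[X]) ≠ 0 := by
      refine mul_ne_zero (by exact_mod_cast (two_ne_zero : (2 : ℤ[X]) ≠ 0)) ?_
      rw [← C_1]; exact Polynomial.X_add_C_ne_zero 1
    apply mul_left_cancel₀ hne
    linear_combination (-1 : ℤ[X]) * h
  have e := congrArg (Polynomial.map (Int.castRingHom R)) hZ
  simp only [Polynomial.map_sub, Polynomial.map_mul, Polynomial.map_pow, Polynomial.map_add, Polynomial.map_one, Polynomial.map_X, Polynomial.Chebyshev.map_T,
    Polynomial.Chebyshev.map_U] at e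
  exact e

/-- **`T_{2k+1} + 1 = (X + 1)(U_k − U_{k−1})²`** (all `k ∈ ℤ`, any commutative ring; `U_k − U_{k−1} = V_k`, the third-kind Chebyshev polynomial). [Mason–Handscomb (1.18)–(1.20); this file, §1243] -/
theorem chebyshevT_two_mul_add_one_add_one {R : Type*} [CommRing R] (k : ℤ) :
    Polynomial.Chebyshev.T R (2 * k + 1) + 1 = (Polynomial.X + 1) * (Polynomial.Chebyshev.U R k - Polynomial.Chebyshev.U R (k - 1)) ^ 2 := by
  have hZ : Polynomial.Chebyshev.T ℤ (2 * k + 1) + 1 = (Polynomial.X + 1) * (Polynomial.Chebyshev.U ℤ k - Polynomial.Chebyshev.U ℤ (k - 1)) ^ 2 := by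
    have h := (chebyshevT_two_mul_add_one_aux (R := ℤ) k).2
    have hne : (2 * (Polynomial.X - 1) : ℤ[X]) ≠ 0 := by
      refine mul_ne_zero (by exact_mod_cast (two_ne_zero : (2 : ℤ[X]) ≠ 0)) ?_
      rw [← C_1]; exact Polynomial.X_sub_C_ne_zero 1
    apply mul_left_cancel₀ hne
    linear_combination (-1 : ℤ[X]) * h
  have e := congrArg (Polynomial.map (Int.castRingHom R)) hZ
  simp only [Polynomial.map_sub, Polynomial.map_mul, Polynomial.map_pow, Polynomial.map_add, Polynomial.map_one, Polynomial.map_X, Polynomial.Chebyshev.map_T,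
    Polynomial.Chebyshev.map_U] at e
  exact e

/-- **Gauss–Radau–Chebyshev reading: in a domain, `T_{2k+1}(x) = 1 ⟺ x = 1 ∨ (U_k + U_{k−1})(x) = 0`.** [Gautschi Ex. 1.x; this file, §1243] -/
theorem chebyshevT_two_mul_add_one_eval_eq_one_iff {R : Type*} [CommRing R] [IsDomain R] (k : ℤ) (x : R) :
    (Polynomial.Chebyshev.T R (2 * k + 1)).eval x = 1 ↔ x = 1 ∨ (Polynomial.Chebyshev.U R k + Polynomial.Chebyshev.U R (k - 1)).eval x = 0 := by
  have h := congrArg (Polynomial.eval x) (chebyshevT_two_mul_add_one_sub_one (R := R) k)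
  rw [eval_sub, eval_one, eval_mul, eval_pow, eval_sub, eval_X, eval_one] at h
  rw [← sub_eq_zero, h, mul_eq_zero, sub_eq_zero, pow_eq_zero_iff two_ne_zero]

/-- In a domain, `T_{2k+1}(x) = −1 ⟺ x = −1 ∨ (U_k − U_{k−1})(x) = 0`. [this file, §1243] -/
theorem chebyshevT_two_mul_add_one_eval_eq_neg_one_iff {R : Type*} [CommRing R] [IsDomain R] (k : ℤ) (x : R) :
    (Polynomial.Chebyshev.T R (2 * k + 1)).eval x = -1 ↔ x = -1 ∨ (Polynomial.Chebyshev.U R k - Polynomial.Chebyshev.U R (k - 1)).eval x = 0 := by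
  have h := congrArg (Polynomial.eval x) (chebyshevT_two_mul_add_one_add_one (R := R) k)
  rw [eval_add, eval_one, eval_mul, eval_pow, eval_add, eval_X, eval_one] at h
  rw [← sub_eq_zero, sub_neg_eq_add, h, mul_eq_zero, add_eq_zero_iff_eq_neg, pow_eq_zero_iff two_ne_zero]

end Summit.Ventures.HSemireg.Wedge.HankelOuter
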